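import Mathlib

/-!
# Row F11′ of the H(668) census: CONFERENCE GRAPHS `srg(333, 166, 82, 83)` ⇔ symmetric conference matrices `C(334)`
# (⇒ `H(668)`), in the kernel

Framing: lottery ticket; floor = certified bounds/negative ranges.  Cell pub-namedobj (venture DiscreteObjects),
target (H), hadamard gen 27.  PRINT STATUS: classical (Seidel; Brouwer–Haemers, *Spectra of Graphs* (2012) §10.4:
"if `n ≡ 2 (mod 4)`, `S` gives rise to … conference graphs, strongly regular with parameters
`(n − 1, (n − 2)/2, (n − 6)/4, (n − 2)/4)`"); the kernel proofs are ours.  With gen 27's `hadamard668_of_conference334`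
(`ConferenceRoute668`) and `conference334_symm_signing` (`ConferenceSymmetrization`) this ties THREE named open objects
to `H(668)` in the kernel: `H(668) ⇐ C(334) ⇔ symmetric C(334) ⇔ srg(333, 166, 82, 83)` (a conference graph on `333`
vertices; `333 = 18² + 3²` passes the two-squares condition; no construction in print covers `v = 333 = 3²·37`).
Everything is stated entrywise with explicit hypotheses (no new `def`).
* §1 (graph ⇒ matrix, any `μ`): for a `0/1` symmetric zero-diagonal `A` on `v = 4μ + 1` vertices with row sums `2μ` and
  `Σ_z A_xz A_zy = μ(1 + [x = y]) − A_xy` (the `srg(4μ+1, 2μ, μ−1, μ)` identity `A² = μ(J + I) − A`), the Seidel matrix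
  `S = J − I − 2A` is symmetric, `{0, ±1}`, with `S𝟙 = 0` and `S² = vI − J` (`seidel_identities_of_conferenceGraph`), and
  the bordered matrix `C = [[0, 𝟙ᵀ], [𝟙, S]]` on `Option V` is a SYMMETRIC CONFERENCE MATRIX of order `v + 1`
  (`conference_of_conferenceGraph`); **`conference334_of_srg333`** (`v = 333`, `μ = 83`).
* §2 (matrix ⇒ graph, any order): a symmetric conference matrix normalised at `o` (`C_oj = 1`, `j ≠ o`; every symmetric
  `C` becomes so under the symmetric signing `d = e = C_o·`, `symm_normalise`) has `A_ij = (1 − [i = j] − C_ij)/2` on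
  `{i // i ≠ o}` equal to the adjacency matrix of an `srg(n − 1, (n − 2)/2, (n − 6)/4, (n − 2)/4)`: `0/1`, symmetric, zero
  diagonal, row sums `(n − 2)/2`, `4 Σ_z A_xz A_zy = (n − 2)(1 + [x = y]) − 4 A_xy` (`conferenceGraph_of_symm_conference`);
  **`srg333_of_symm_conference334`** (row sums `166`, `Σ_z A_xz A_zy = 83(1 + [x = y]) − A_xy`).
WORDS: dictionary line (replication of classical facts, our proofs); no order excluded; all three objects OPEN.  No `sorry`.
-/

namespace Summit.Ventures.DiscreteObjects.Hadamard

open Finset BigOperators Matrix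

/-! ## §1 Conference graph ⇒ symmetric conference matrix -/

section graphToMatrix
variable {V : Type*} [Fintype V] [DecidableEq V]

/-- **Seidel identities of a conference graph** (entrywise).  With `S_xy = 1 − [x = y] − 2 A_xy`: zero diagonal, `±1`
off the diagonal, symmetric, zero row sums, and `Σ_z S_xz S_zy = v[x = y] − 1`. -/
theorem seidel_identities_of_conferenceGraph (A : Matrix V V ℤ) (h01 : ∀ x y, A x y = 0 ∨ A x y = 1)
    (hsymm : ∀ x y, A y x = A x y) (hdiag : ∀ x, A x x = 0) (μ : ℤ) (hv : (Fintype.card V : ℤ) = 4 * μ + 1)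
    (hk : ∀ x, ∑ y, A x y = 2 * μ) (hsrg : ∀ x y, ∑ z, A x z * A z y = μ * (1 + (if x = y then 1 else 0)) - A x y) :
    (∀ x, (1 - (if x = x then 1 else 0) - 2 * A x x : ℤ) = 0) ∧
    (∀ x y, x ≠ y → (1 - (if x = y then 1 else 0) - 2 * A x y : ℤ) = 1 ∨ (1 - (if x = y then 1 else 0) - 2 * A x y : ℤ) = -1) ∧
    (∀ x y, (1 - (if y = x then 1 else 0) - 2 * A y x : ℤ) = 1 - (if x = y then 1 else 0) - 2 * A x y) ∧
    (∀ x, ∑ y, (1 - (if x = y then 1 else 0) - 2 * A x y : ℤ) = 0) ∧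
    (∀ x y, ∑ z, (1 - (if x = z then 1 else 0) - 2 * A x z : ℤ) * (1 - (if z = y then 1 else 0) - 2 * A z y) =
      (Fintype.card V : ℤ) * (if x = y then 1 else 0) - 1) := by
  have hk' : ∀ y, ∑ z, A z y = 2 * μ := fun y => by
    rw [Finset.sum_congr rfl (fun z _ => hsymm y z)]
    exact hk y
  refine ⟨fun x => by rw [if_pos rfl, hdiag]; ring, fun x y hxy => ?_, fun x y => ?_, fun x => ?_, fun x y => ?_⟩
  · rw [if_neg hxy]; rcases h01 x y with h | h <;> rw [h] <;> norm_num
  · rw [hsymm x y]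
    by_cases h : x = y
    · rw [h]
    · rw [if_neg h, if_neg (Ne.symm h)]
  · rw [Finset.sum_sub_distrib, Finset.sum_sub_distrib, Finset.sum_const, Finset.card_univ, Finset.sum_ite_eq Finset.univ x,
      if_pos (Finset.mem_univ _), ← Finset.mul_sum, hk x]
    simp; linarith
  · have e : ∀ z, (1 - (if x = z then 1 else 0) - 2 * A x z : ℤ) * (1 - (if z = y then 1 else 0) - 2 * A z y) =
        1 - (if z = y then 1 else 0) - 2 * A z y - (if x = z then 1 else 0) + (if x = z then (if z = y then 1 else 0) else 0)
        + (if x = z then 2 * A z y else 0) - 2 * A x z + (if z = y then 2 * A x z else 0) + 4 * (A x z * A z y) := by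
      intro z; split_ifs <;> ring
    rw [Finset.sum_congr rfl (fun z _ => e z)]
    simp only [Finset.sum_add_distrib, Finset.sum_sub_distrib, Finset.sum_const, Finset.card_univ, Finset.sum_ite_eq,
      Finset.sum_ite_eq', Finset.mem_univ, if_true, ← Finset.mul_sum, hk x, hk' y, hsrg x y, nsmul_eq_mul, mul_one]
    split_ifs <;> linarith [hv]

/-- **The bordered Seidel matrix is a symmetric conference matrix.**  Under the hypotheses above, the matrix `C` on
`Option V` with `C(none,none) = 0`, `C(none, some y) = C(some x, none) = 1`, `C(some x, some y) = S_xy` has zero diagonal,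
`±1` off the diagonal, is symmetric and satisfies `C Cᵀ = v·I = (|Option V| − 1)·I`. -/
theorem conference_of_conferenceGraph (A : Matrix V V ℤ) (h01 : ∀ x y, A x y = 0 ∨ A x y = 1)
    (hsymm : ∀ x y, A y x = A x y) (hdiag : ∀ x, A x x = 0) (μ : ℤ) (hv : (Fintype.card V : ℤ) = 4 * μ + 1)
    (hk : ∀ x, ∑ y, A x y = 2 * μ) (hsrg : ∀ x y, ∑ z, A x z * A z y = μ * (1 + (if x = y then 1 else 0)) - A x y) :
    let C : Matrix (Option V) (Option V) ℤ := Matrix.of fun p q => Option.elim p (Option.elim q 0 (fun _ => 1))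
      (fun x => Option.elim q 1 (fun y => 1 - (if x = y then 1 else 0) - 2 * A x y))
    (∀ p, C p p = 0) ∧ (∀ p q, p ≠ q → C p q = 1 ∨ C p q = -1) ∧ (∀ p q, C q p = C p q) ∧
      C * Cᵀ = ((Fintype.card (Option V) : ℤ) - 1) • (1 : Matrix (Option V) (Option V) ℤ) := by
  intro C
  obtain ⟨hSd, hSo, hSs, hS1, hSS⟩ := seidel_identities_of_conferenceGraph A h01 hsymm hdiag μ hv hk hsrg
  have hCnn : C none none = 0 := rfl
  have hCns : ∀ y, C none (some y) = 1 := fun _ => rfl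
  have hCsn : ∀ x, C (some x) none = 1 := fun _ => rfl
  have hCss : ∀ x y, C (some x) (some y) = 1 - (if x = y then 1 else 0) - 2 * A x y := fun _ _ => rfl
  have hsym : ∀ p q, C q p = C p q := by
    rintro (_ | x) (_ | y)
    · rfl
    · rw [hCns, hCsn]
    · rw [hCns, hCsn]
    · rw [hCss, hCss]; exact hSs x y
  refine ⟨?_, ?_, hsym, ?_⟩
  · rintro (_ | x)
    · rfl
    · rw [hCss]; exact hSd x
  · rintro (_ | x) (_ | y) hpq
    · exact absurd rfl hpq
    · left; rfl
    · left; rfl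
    · rw [hCss]; exact hSo x y (fun h => hpq (by rw [h]))
  · ext p q
    rw [Matrix.mul_apply, Fintype.sum_option, Matrix.smul_apply, Matrix.one_apply, smul_eq_mul]
    simp only [Matrix.transpose_apply]
    have hcard : (Fintype.card (Option V) : ℤ) - 1 = Fintype.card V := by
      rw [Fintype.card_option]; push_cast; ring
    rw [hcard]
    rcases p with _ | x <;> rcases q with _ | y
    · simp [hCnn, hCns]
    · simp only [hCnn, hCns, hCsn, hCss, zero_mul, zero_add, one_mul]
      rw [hS1 y]; simp
    · simp only [hCnn, hCns, hCsn, hCss, mul_zero, zero_add, mul_one]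
      rw [hS1 x]; simp
    · simp only [hCsn, hCss, mul_one, Option.some.injEq]
      rw [Finset.sum_congr rfl (fun z _ => by rw [hSs z y]), hSS x y]
      split_ifs <;> ring

/-- **Row F11′: an `srg(333, 166, 82, 83)` (conference graph on `333` vertices) gives a symmetric conference matrix of
order `334`** — hence, by `hadamard668_of_conference334` (`ConferenceRoute668`), a Hadamard matrix of order `668`.
The srg identity is `Σ_z A_xz A_zy = 166[x = y] + 82 A_xy [x ∼ y] + 83 (1 − [x=y] − A_xy)`, i.e. `83(1 + [x = y]) − A_xy`. -/
theorem conference334_of_srg333 (hV : Fintype.card V = 333) (A : Matrix V V ℤ) (h01 : ∀ x y, A x y = 0 ∨ A x y = 1)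
    (hsymm : ∀ x y, A y x = A x y) (hdiag : ∀ x, A x x = 0) (hk : ∀ x, ∑ y, A x y = 166)
    (hsrg : ∀ x y, ∑ z, A x z * A z y = 83 * (1 + (if x = y then 1 else 0)) - A x y) :
    let C : Matrix (Option V) (Option V) ℤ := Matrix.of fun p q => Option.elim p (Option.elim q 0 (fun _ => 1))
      (fun x => Option.elim q 1 (fun y => 1 - (if x = y then 1 else 0) - 2 * A x y))
    (∀ p, C p p = 0) ∧ (∀ p q, p ≠ q → C p q = 1 ∨ C p q = -1) ∧ (∀ p q, C q p = C p q) ∧ C * Cᵀ = (333 : ℤ) • 1 ∧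
      Fintype.card (Option V) = 334 := by
  intro C
  obtain ⟨h1, h2, h3, h4⟩ := conference_of_conferenceGraph A h01 hsymm hdiag 83 (by rw [hV]; norm_num)
    (fun x => by rw [hk x]; norm_num) hsrg
  refine ⟨h1, h2, h3, ?_, by rw [Fintype.card_option, hV]⟩
  rw [h4, Fintype.card_option, hV]; norm_num

end graphToMatrix

/-! ## §2 Symmetric conference matrix ⇒ conference graph -/

section matrixToGraph
variable {ι : Type*} [Fintype ι] [DecidableEq ι]

/-- rows of a conference matrix: `Σ_k C_ik C_jk = (n − 1)[i = j]`. -/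
private theorem conference_inner' {C : Matrix ι ι ℤ} (hC : C * Cᵀ = ((Fintype.card ι : ℤ) - 1) • (1 : Matrix ι ι ℤ))
    (i j : ι) : ∑ k, C i k * C j k = if i = j then (Fintype.card ι : ℤ) - 1 else 0 := by
  have e := congrFun (congrFun hC i) j
  rw [Matrix.mul_apply] at e
  simpa [Matrix.transpose_apply, Matrix.smul_apply, Matrix.one_apply] using e

/-- **symmetric normalisation**: for a SYMMETRIC conference matrix `C` and a point `o`, the symmetric signing by
`d_i = C_oi (i ≠ o)`, `d_o = 1` gives a symmetric conference matrix with `C'_oj = 1` for `j ≠ o`. -/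
theorem symm_normalise {C : Matrix ι ι ℤ} (hdiag : ∀ i, C i i = 0) (hoff : ∀ i j, i ≠ j → C i j = 1 ∨ C i j = -1)
    (hC : C * Cᵀ = ((Fintype.card ι : ℤ) - 1) • (1 : Matrix ι ι ℤ)) (hsym : ∀ i j, C j i = C i j) (o : ι) :
    (∀ i, (Matrix.of fun i j => (if i = o then (1 : ℤ) else C o i) * C i j * (if j = o then (1 : ℤ) else C o j)) i i = 0) ∧
    (∀ i j, i ≠ j →
      (Matrix.of fun i j => (if i = o then (1 : ℤ) else C o i) * C i j * (if j = o then (1 : ℤ) else C o j)) i j = 1 ∨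
      (Matrix.of fun i j => (if i = o then (1 : ℤ) else C o i) * C i j * (if j = o then (1 : ℤ) else C o j)) i j = -1) ∧
    (Matrix.of fun i j => (if i = o then (1 : ℤ) else C o i) * C i j * (if j = o then (1 : ℤ) else C o j)) *
      (Matrix.of fun i j => (if i = o then (1 : ℤ) else C o i) * C i j * (if j = o then (1 : ℤ) else C o j))ᵀ =
      ((Fintype.card ι : ℤ) - 1) • 1 ∧
    (∀ i j, (Matrix.of fun i j => (if i = o then (1 : ℤ) else C o i) * C i j * (if j = o then (1 : ℤ) else C o j)) j i =
      (Matrix.of fun i j => (if i = o then (1 : ℤ) else C o i) * C i j * (if j = o then (1 : ℤ) else C o j)) i j) ∧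
    (∀ j, j ≠ o →
      (Matrix.of fun i j => (if i = o then (1 : ℤ) else C o i) * C i j * (if j = o then (1 : ℤ) else C o j)) o j = 1) := by
  have hd : ∀ i, (if i = o then (1 : ℤ) else C o i) = 1 ∨ (if i = o then (1 : ℤ) else C o i) = -1 := by
    intro i; by_cases hi : i = o
    · rw [if_pos hi]; exact Or.inl rfl
    · rw [if_neg hi]; exact hoff o i (Ne.symm hi)
  have hdsq : ∀ i, (if i = o then (1 : ℤ) else C o i) * (if i = o then (1 : ℤ) else C o i) = 1 := by
    intro i; rcases hd i with h | h <;> rw [h] <;> norm_num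
  refine ⟨fun i => by simp [hdiag], fun i j hij => ?_, ?_, fun i j => ?_, fun j hj => ?_⟩
  · simp only [Matrix.of_apply]
    rcases hd i with h1 | h1 <;> rcases hoff i j hij with h2 | h2 <;> rcases hd j with h3 | h3 <;>
      rw [h1, h2, h3] <;> norm_num
  · ext i j
    rw [Matrix.mul_apply, Matrix.smul_apply, Matrix.one_apply, smul_eq_mul]
    have hterm : ∀ k, (Matrix.of fun i j => (if i = o then (1 : ℤ) else C o i) * C i j * (if j = o then (1 : ℤ) else C o j)) i k *
        (Matrix.of fun i j => (if i = o then (1 : ℤ) else C o i) * C i j * (if j = o then (1 : ℤ) else C o j))ᵀ k j =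
        (if i = o then (1 : ℤ) else C o i) * (if j = o then (1 : ℤ) else C o j) * (C i k * C j k) := by
      intro k; simp only [Matrix.of_apply, Matrix.transpose_apply]
      linear_combination (if i = o then (1 : ℤ) else C o i) * (if j = o then (1 : ℤ) else C o j) * C i k * C j k * hdsq k
    rw [Finset.sum_congr rfl (fun k _ => hterm k), ← Finset.mul_sum, conference_inner' hC]
    by_cases hij : i = j
    · subst hij; rw [if_pos rfl, if_pos rfl, hdsq, one_mul, mul_one]
    · rw [if_neg hij, if_neg hij, mul_zero, mul_zero]
  · simp only [Matrix.of_apply, hsym i j]; ring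
  · rw [Matrix.of_apply, if_pos rfl, if_neg hj, one_mul]
    rcases hoff o j (Ne.symm hj) with h | h <;> rw [h] <;> norm_num

/-- **core identities** of a conference matrix normalised at `o` (`C_oj = C_jo = 1`, `j ≠ o`): zero core row sums and
`Σ_{k ≠ o} C_ik C_jk = (n − 1)[i = j] − 1` for core indices. -/
theorem core_identities {C : Matrix ι ι ℤ} (hdiag : ∀ i, C i i = 0)
    (hC : C * Cᵀ = ((Fintype.card ι : ℤ) - 1) • (1 : Matrix ι ι ℤ)) (o : ι) (hrow : ∀ j, j ≠ o → C o j = 1)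
    (hcol : ∀ i, i ≠ o → C i o = 1) {i j : ι} (hio : i ≠ o) (hjo : j ≠ o) :
    (∑ k ∈ Finset.univ.erase o, C i k = 0) ∧
    (∑ k ∈ Finset.univ.erase o, C i k * C j k = (if i = j then (Fintype.card ι : ℤ) - 1 else 0) - 1) := by
  constructor
  · have h0 := conference_inner' hC i o
    rw [if_neg hio, ← Finset.add_sum_erase _ _ (Finset.mem_univ o), hdiag, mul_zero, zero_add] at h0
    rw [← h0]
    exact Finset.sum_congr rfl (fun k hk => by rw [hrow k (Finset.mem_erase.mp hk).1, mul_one])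
  · have h0 := conference_inner' hC i j
    rw [← Finset.add_sum_erase _ _ (Finset.mem_univ o), hcol i hio, hcol j hjo, one_mul] at h0
    linarith

/-- **Symmetric conference matrix ⇒ conference graph.**  For a symmetric conference matrix `C` of order `n` normalised at
`o`, the matrix `A_ij = (1 − [i = j] − C_ij)/2` on the core `{i // i ≠ o}` is `0/1`, symmetric, zero-diagonal, with row
sums `(n − 2)/2` and `4 Σ_z A_xz A_zy = (n − 2)(1 + [x = y]) − 4 A_xy` — the adjacency matrix of an
`srg(n − 1, (n − 2)/2, (n − 6)/4, (n − 2)/4)` (conference graph). -/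
theorem conferenceGraph_of_symm_conference {C : Matrix ι ι ℤ} (hdiag : ∀ i, C i i = 0)
    (hoff : ∀ i j, i ≠ j → C i j = 1 ∨ C i j = -1) (hC : C * Cᵀ = ((Fintype.card ι : ℤ) - 1) • (1 : Matrix ι ι ℤ))
    (hsym : ∀ i j, C j i = C i j) (o : ι) (hrow : ∀ j, j ≠ o → C o j = 1) :
    let A : Matrix {i // i ≠ o} {i // i ≠ o} ℤ := Matrix.of fun x y => (1 - (if x = y then 1 else 0) - C x.1 y.1) / 2
    (∀ x y, A x y = 0 ∨ A x y = 1) ∧ (∀ x y, A y x = A x y) ∧ (∀ x, A x x = 0) ∧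
      (∀ x y, 2 * A x y = 1 - (if x = y then 1 else 0) - C x.1 y.1) ∧
      (∀ x, 2 * ∑ y, A x y = (Fintype.card ι : ℤ) - 2) ∧
      (∀ x y, 4 * ∑ z, A x z * A z y = ((Fintype.card ι : ℤ) - 2) * (1 + (if x = y then 1 else 0)) - 4 * A x y) := by
  intro A
  have hcol : ∀ i, i ≠ o → C i o = 1 := fun i hi => by rw [hsym]; exact hrow i hi
  have hA2 : ∀ x y : {i // i ≠ o}, 2 * A x y = 1 - (if x = y then 1 else 0) - C x.1 y.1 := by
    intro x y
    simp only [A, Matrix.of_apply]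
    by_cases hxy : x = y
    · rw [if_pos hxy, hxy, hdiag]; norm_num
    · rw [if_neg hxy]
      have hne : x.1 ≠ y.1 := fun h => hxy (Subtype.ext h)
      rcases hoff x.1 y.1 hne with h | h <;> rw [h] <;> norm_num
  have h01 : ∀ x y : {i // i ≠ o}, A x y = 0 ∨ A x y = 1 := by
    intro x y
    have h := hA2 x y
    by_cases hxy : x = y
    · subst hxy; rw [if_pos rfl, hdiag] at h; left; linarith
    · rw [if_neg hxy] at h
      have hne : x.1 ≠ y.1 := fun h => hxy (Subtype.ext h)
      rcases hoff x.1 y.1 hne with h' | h' <;> rw [h'] at h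
      · left; linarith
      · right; linarith
  -- sums over the core subtype are sums over `univ.erase o`; the core has `n − 1` points
  have hsub : ∀ f : ι → ℤ, ∑ y : {i // i ≠ o}, f y.1 = ∑ k ∈ Finset.univ.erase o, f k := by
    intro f
    exact (Finset.sum_subtype (Finset.univ.erase o) (p := fun i => i ≠ o) (fun k => by simp) f).symm
  have hpos : 0 < Fintype.card ι := Fintype.card_pos_iff.mpr ⟨o⟩
  have hcore : (Fintype.card {i // i ≠ o} : ℤ) = Fintype.card ι - 1 := by
    rw [Fintype.card_subtype, Finset.filter_ne', Finset.card_erase_of_mem (Finset.mem_univ o), Finset.card_univ,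
      Nat.cast_sub hpos, Nat.cast_one]
  refine ⟨h01, fun x y => ?_, fun x => ?_, hA2, fun x => ?_, fun x y => ?_⟩
  · simp only [A, Matrix.of_apply, hsym x.1 y.1]
    by_cases h : x = y
    · rw [h]
    · rw [if_neg h, if_neg (Ne.symm h)]
  · rcases h01 x x with h | h
    · exact h
    · exfalso; have := hA2 x x; rw [if_pos rfl, hdiag, h] at this; norm_num at this
  · rw [Finset.mul_sum, Finset.sum_congr rfl (fun y _ => hA2 x y), Finset.sum_sub_distrib, Finset.sum_sub_distrib,
      Finset.sum_const, Finset.card_univ, Finset.sum_ite_eq Finset.univ x, if_pos (Finset.mem_univ _),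
      hsub (fun k => C x.1 k), (core_identities hdiag hC o hrow hcol x.2 x.2).1, nsmul_eq_mul, mul_one, hcore]
    ring
  · -- 4 Σ_z A x z A z y = Σ_z (2 A x z)(2 A z y)
    have e1 : 4 * ∑ z, A x z * A z y = ∑ z, (2 * A x z) * (2 * A z y) := by
      rw [Finset.mul_sum]; exact Finset.sum_congr rfl (fun z _ => by ring)
    have hAzy : ∀ z, 2 * A z y = 1 - (if z = y then 1 else 0) - C y.1 z.1 := fun z => by rw [hA2 z y, hsym]
    rw [e1, Finset.sum_congr rfl (fun z _ => by rw [hA2 x z, hAzy z])]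
    have e2 : ∀ z : {i // i ≠ o}, (1 - (if x = z then 1 else 0) - C x.1 z.1) * (1 - (if z = y then 1 else 0) - C y.1 z.1) =
        1 - (if z = y then 1 else 0) - C y.1 z.1 - (if x = z then 1 else 0) + (if x = z then (if z = y then 1 else 0) else 0)
        + (if x = z then C y.1 z.1 else 0) - C x.1 z.1 + (if z = y then C x.1 z.1 else 0) + C x.1 z.1 * C y.1 z.1 := by
      intro z; split_ifs <;> ring
    rw [Finset.sum_congr rfl (fun z _ => e2 z)]
    simp only [Finset.sum_add_distrib, Finset.sum_sub_distrib, Finset.sum_const, Finset.card_univ, Finset.sum_ite_eq,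
      Finset.sum_ite_eq', Finset.mem_univ, if_true]
    rw [hsub (fun k => C x.1 k), hsub (fun k => C y.1 k), hsub (fun k => C x.1 k * C y.1 k),
      (core_identities hdiag hC o hrow hcol x.2 x.2).1, (core_identities hdiag hC o hrow hcol y.2 y.2).1,
      (core_identities hdiag hC o hrow hcol x.2 y.2).2, hsym x.1 y.1, nsmul_eq_mul, mul_one, hcore]
    have hx2 := hA2 x y
    have hval : ∀ {a b : {i // i ≠ o}}, ((a : ι) = b) = (a = b) := fun {a b} => propext Subtype.ext_iff.symm
    simp only [hval]
    split_ifs at hx2 ⊢ <;> linarith [hx2]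

/-- **Row F11′ converse at `334`: the core graph of a symmetric conference matrix of order `334` normalised at `o` is an
`srg(333, 166, 82, 83)`** (row sums `166`; `Σ_z A_xz A_zy = 83(1 + [x = y]) − A_xy`). -/
theorem srg333_of_symm_conference334 (hι : Fintype.card ι = 334) {C : Matrix ι ι ℤ} (hdiag : ∀ i, C i i = 0)
    (hoff : ∀ i j, i ≠ j → C i j = 1 ∨ C i j = -1) (hC : C * Cᵀ = (333 : ℤ) • (1 : Matrix ι ι ℤ))
    (hsym : ∀ i j, C j i = C i j) (o : ι) (hrow : ∀ j, j ≠ o → C o j = 1) :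
    let A : Matrix {i // i ≠ o} {i // i ≠ o} ℤ := Matrix.of fun x y => (1 - (if x = y then 1 else 0) - C x.1 y.1) / 2
    (∀ x y, A x y = 0 ∨ A x y = 1) ∧ (∀ x y, A y x = A x y) ∧ (∀ x, A x x = 0) ∧ (∀ x, ∑ y, A x y = 166) ∧
      (∀ x y, ∑ z, A x z * A z y = 83 * (1 + (if x = y then 1 else 0)) - A x y) ∧ Fintype.card {i // i ≠ o} = 333 := by
  intro A
  have hC' : C * Cᵀ = ((Fintype.card ι : ℤ) - 1) • (1 : Matrix ι ι ℤ) := by rw [hC, hι]; norm_num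
  obtain ⟨h1, h2, h3, -, h5, h6⟩ := conferenceGraph_of_symm_conference hdiag hoff hC' hsym o hrow
  refine ⟨h1, h2, h3, fun x => ?_, fun x y => ?_, ?_⟩
  · have := h5 x; rw [hι] at this; push_cast at this; linarith
  · have := h6 x y; rw [hι] at this; push_cast at this; linarith
  · rw [Fintype.card_subtype, Finset.filter_ne', Finset.card_erase_of_mem (Finset.mem_univ o), Finset.card_univ, hι]

end matrixToGraph

end Summit.Ventures.DiscreteObjects.Hadamard
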